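import Summits.HodgeConjecture.Ring2.NonSimpleFivefoldsRowEET
import Literature.AlgebraicGeometry.HodgeTheory.RankOneCentreTimesSimpleCMSurfaceProductSpan
import HarnessLib

/-!
# Moonen–Zarhin 1999 Thm. 0.2 (4) for non-simple complex abelian fivefolds — COMPLETE: every complex abelian variety of dimension `≤ 5`, not a simple fivefold, without simple fourfold isogeny factor, outside the printed cases (a)/(e)/(f), satisfies `B•(Xⁿ) = D•(Xⁿ)` for all `n` (NO displayed row)

Cell `pub-hodge-ring2` (HONEST FRAMING: research route conditional on HC_CM; not a corollary; Q11.4-sentence-2 already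
refuted in dim ≥ 3), Literature lane, programme R28 — Summit-side, theorem-only (no definition, no named fact, no `sorry`,
NO HC_CM). The prequel `Ring2/NonSimpleFivefoldsRowEET` discharged the row (5.11) and displayed the single row (5.10)
`hST` «`X ∼ Y₁ × Y₂`, `Y₁` a simple abelian surface [of CM type: `Hg(Y₁) = U_{F₁}`], `Y₂` a simple abelian threefold …
not of CM-type [all factors of Type IV]»; the tree now proves that row —
`Literature.AlgebraicGeometry.HodgeTheory.isStablyNondegenerate_simpleCMSurface_prod_threefold_of_typeIV_of_not_isOfCMType`
(Moonen–Zarhin Lemma (3.6) for the `ℚ`-simple rank-two torus `U_{F₁}` against the rank-one centre `U_{k''}` of `Hg(Y₂)`: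
abstract Lie step `Motives/HodgeThetaAnnihilatorRankOneCentreTimesQSimpleTorus`, skew commutant
`Motives/HodgeEndActionEigenlineSkewCommutant`, word-model transfer `Motives/HodgeTensorAnnihilatorDiagonalTransfer`,
Galois input `NumberTheory/ComplexMultiplication/QuarticCMUnitaryTorusQSimple`, «no imaginary quadratic subfield»
`HodgeTheory/SimpleCMSurfaceNoQuadraticSkewSquare`, geometry `HodgeTheory/RankOneCentreTimesSimpleCMSurfaceProductSpan`).

RESULTS (all hypothesis lists are the PRINTED exclusions only).
* `rowST` — the row (5.10) as a theorem, in the shape displayed by the prequels.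
* **`isStablyNondegenerate_of_dim_eq_five_of_not_isSimple`** — Moonen–Zarhin Thm. 0.2 (4) for EVERY non-simple complex
  abelian fivefold `X` without simple isogeny factor of dimension `4`, outside (e)/(f) («`X₁` an elliptic curve with
  complex multiplication by `k` and `X₂` a simple abelian threefold such that `k ↪ End⁰(X₂)`», relative to `X`):
  `B•(Xⁿ) = D•(Xⁿ)` for all `n`; `hodgeConjectureFor_powSucc_of_dim_eq_five_of_not_isSimple` — the Hodge conjecture for
  all powers.
* **`isStablyNondegenerate_of_dim_le_five`** — Thm. 0.1 (4) AND Thm. 0.2 (4) in one statement: `0 < dim X ≤ 5`, `X` not a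
  simple fivefold, no simple fourfold factor, outside (a)/(e)/(f); `hodgeConjectureFor_powSucc_of_dim_le_five`.
* **`hcOnClass_avDominatedBy_powSucc_dim_le_five`** — the class target: the Hodge conjecture on everything dominated by a
  power of such an `X` — UNCONDITIONAL, no displayed row, no HC_CM.
NOT asserted (printed exceptions): simple fivefolds; a simple fourfold factor (Thm. 0.2 (2)–(3): exceptional classes may
occur); cases (a)/(e)/(f) (`k ↪ End⁰(T)`: Weil classes, Thm. 0.2 (1)).

## References
* [MoonenZarhin1999LowDim] B. Moonen, Yu. Zarhin, Math. Ann. 315 (1999) 711–733: Thm. 0.1 (4), Thm. 0.2 (4) with (a)/(e)/(f),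
  §3 Lemma (3.6), Prop. (3.8), §5 (5.6)–(5.11) (held `paper:arxiv-math_9901113` chunks p0001–p0002, p0007, p0009–p0010).
  [cite: MoonenZarhin1999LowDim, Thm. 0.2 (4) and §5 (5.10)]
* [MumfordAV1970] D. Mumford, *Abelian Varieties*, §19 Thm. 1 (Poincaré reducibility), §21. [cite: MumfordAV1970, §19 Thm. 1 (pp. 173–174)]
* [Deligne2000] P. Deligne, *The Hodge conjecture* (Clay, 2000), §1. [cite: Deligne2000, §1]
-/

noncomputable section

open CategoryTheory CategoryTheory.Limits

namespace Summit.HodgeConjecture.Ring2.NonSimpleFivefolds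

open Literature.AlgebraicGeometry.Motives (AbelianVariety)
open Literature.AlgebraicGeometry.Motives.AbelianVariety
open Literature.AlgebraicGeometry.HodgeTheory
open Literature.AlgebraicGeometry.Milne1999
open Summit.HodgeConjecture.CorCM
open Summit.HodgeConjecture.CorCM.Domination
open Summit.HodgeConjecture.HodgeConjecture.Ring2.ClassTargets (HCOnClass)

variable {X : AbelianVariety ℂ}

/-! ### §1 The row (5.10) as a theorem -/

/-- **The row (5.10) of Moonen–Zarhin Thm. 0.2 (4)** — a simple abelian surface of CM type times a simple abelian threefold
of Type IV not of CM type is stably nondegenerate — in the displayed shape of the prequels, BY NAME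
(`isStablyNondegenerate_simpleCMSurface_prod_threefold_of_typeIV_of_not_isOfCMType`: Lemma (3.6) for `Hg(Y₁) = U_{F₁}`,
`F₁` without imaginary quadratic subfield). [cite: MoonenZarhin1999LowDim, §3 Lemma (3.6) and §5 (5.10)] -/
theorem rowST : ∀ S T : AbelianVariety ℂ, S.dim = 2 → S.IsSimple → IsOfCMType S → T.dim = 3 → T.IsSimple →
    ¬ IsOfCMType T → ¬ HasNoTypeIVFactor T → IsStablyNondegenerate (S.prod T) :=
  fun _ _ hS2 hSs hSc hT3 hTs hTc hT4 =>
    isStablyNondegenerate_simpleCMSurface_prod_threefold_of_typeIV_of_not_isOfCMType hS2 hSs hSc hT3 hTs hTc hT4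

/-! ### §2 Non-simple fivefolds: Thm. 0.2 (4), no displayed row -/

/-- **Moonen–Zarhin 1999 Thm. 0.2 (4) for non-simple fivefolds — every row a theorem.** Every NON-SIMPLE complex abelian
FIVEFOLD `X` without simple isogeny factor of dimension `4` and outside the printed cases (e)/(f) (no elliptic curve `E` of
CM type and simple threefold `T` dominated by `X` with `End⁰(E) ↪ End⁰(T)`) is stably nondegenerate: `B•(Xⁿ) = D•(Xⁿ)`
for every `n` («if `X` has no simple factor of dimension 4 then `B•(Xⁿ) = D•(Xⁿ)` for every `n ≥ 1`», outside (e)/(f)).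
[cite: MoonenZarhin1999LowDim, Thm. 0.2 (4) and §5 (5.6)–(5.11)] [cite: MumfordAV1970, §19 Thm. 1 (pp. 173–174)] -/
theorem isStablyNondegenerate_of_dim_eq_five_of_not_isSimple (hX5 : X.dim = 5) (hX : ¬ X.IsSimple)
    (h4 : ∀ F : AbelianVariety ℂ, F.IsSimple → F.dim = 4 → ¬ AVDominatedBy F X)
    (hna : ¬ ∃ E T : AbelianVariety ℂ, E.dim = 1 ∧ IsOfCMType E ∧ T.IsSimple ∧ T.dim = 3 ∧
      AVDominatedBy E X ∧ AVDominatedBy T X ∧ Nonempty (E.endAlgebra →+* T.endAlgebra)) :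
    IsStablyNondegenerate X :=
  isStablyNondegenerate_of_dim_eq_five_of_not_isSimple_of_rowST' rowST hX5 hX h4 hna

/-- **The Hodge conjecture for every power of every such fivefold** — UNCONDITIONAL (no HC_CM, no displayed row).
[cite: MoonenZarhin1999LowDim, Thm. 0.2 (4)] -/
theorem hodgeConjectureFor_powSucc_of_dim_eq_five_of_not_isSimple (hX5 : X.dim = 5) (hX : ¬ X.IsSimple)
    (h4 : ∀ F : AbelianVariety ℂ, F.IsSimple → F.dim = 4 → ¬ AVDominatedBy F X)
    (hna : ¬ ∃ E T : AbelianVariety ℂ, E.dim = 1 ∧ IsOfCMType E ∧ T.IsSimple ∧ T.dim = 3 ∧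
      AVDominatedBy E X ∧ AVDominatedBy T X ∧ Nonempty (E.endAlgebra →+* T.endAlgebra)) (N : ℕ) :
    HodgeConjectureFor (X.powSucc N).dim (X.powSucc N).X :=
  (isStablyNondegenerate_of_dim_eq_five_of_not_isSimple hX5 hX h4 hna).hodgeConjectureFor_powSucc N

/-- The Hodge conjecture for the fivefold itself. [cite: MoonenZarhin1999LowDim, Thm. 0.2 (4)] -/
theorem hodgeConjectureFor_of_dim_eq_five_of_not_isSimple (hX5 : X.dim = 5) (hX : ¬ X.IsSimple)
    (h4 : ∀ F : AbelianVariety ℂ, F.IsSimple → F.dim = 4 → ¬ AVDominatedBy F X)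
    (hna : ¬ ∃ E T : AbelianVariety ℂ, E.dim = 1 ∧ IsOfCMType E ∧ T.IsSimple ∧ T.dim = 3 ∧
      AVDominatedBy E X ∧ AVDominatedBy T X ∧ Nonempty (E.endAlgebra →+* T.endAlgebra)) :
    HodgeConjectureFor X.dim X.X :=
  (isStablyNondegenerate_of_dim_eq_five_of_not_isSimple hX5 hX h4 hna).hodgeConjectureFor

/-! ### §3 Dimension `≤ 5`: Thm. 0.1 (4) and Thm. 0.2 (4) in one statement -/

/-- **Moonen–Zarhin Thm. 0.1 (4) and Thm. 0.2 (4), unified, every row a theorem**: every complex abelian variety `X` with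
`0 < dim X ≤ 5`, not a simple fivefold, with no simple isogeny factor of dimension `4`, outside the printed cases
(a)/(e)/(f), satisfies `B•(Xⁿ) = D•(Xⁿ)` for all `n`. [cite: MoonenZarhin1999LowDim, Thm. 0.1 (4) and Thm. 0.2 (4)]
[cite: MumfordAV1970, §19 Thm. 1 (pp. 173–174)] -/
theorem isStablyNondegenerate_of_dim_le_five (h0 : 0 < X.dim) (h5 : X.dim ≤ 5) (hX : X.dim = 5 → ¬ X.IsSimple)
    (h4 : ∀ F : AbelianVariety ℂ, F.IsSimple → F.dim = 4 → ¬ AVDominatedBy F X)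
    (hna : ¬ ∃ E T : AbelianVariety ℂ, E.dim = 1 ∧ IsOfCMType E ∧ T.IsSimple ∧ T.dim = 3 ∧
      AVDominatedBy E X ∧ AVDominatedBy T X ∧ Nonempty (E.endAlgebra →+* T.endAlgebra)) :
    IsStablyNondegenerate X :=
  isStablyNondegenerate_of_dim_le_five_of_rowST h0 h5 hX h4 hna
    (fun S T hS2 hSs hSc hT3 hTs hTc hT4 _ => rowST S T hS2 hSs hSc hT3 hTs hTc hT4)

/-- **The Hodge conjecture for every power of every such `X`** — UNCONDITIONAL. [cite: MoonenZarhin1999LowDim, Thm. 0.1 (4) and Thm. 0.2 (4)] -/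
theorem hodgeConjectureFor_powSucc_of_dim_le_five (h0 : 0 < X.dim) (h5 : X.dim ≤ 5)
    (hX : X.dim = 5 → ¬ X.IsSimple) (h4 : ∀ F : AbelianVariety ℂ, F.IsSimple → F.dim = 4 → ¬ AVDominatedBy F X)
    (hna : ¬ ∃ E T : AbelianVariety ℂ, E.dim = 1 ∧ IsOfCMType E ∧ T.IsSimple ∧ T.dim = 3 ∧
      AVDominatedBy E X ∧ AVDominatedBy T X ∧ Nonempty (E.endAlgebra →+* T.endAlgebra)) (N : ℕ) :
    HodgeConjectureFor (X.powSucc N).dim (X.powSucc N).X :=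
  (isStablyNondegenerate_of_dim_le_five h0 h5 hX h4 hna).hodgeConjectureFor_powSucc N

/-- **Class target: the Hodge conjecture on everything dominated by a power of a complex abelian variety of dimension
`≤ 5`, not a simple fivefold, without simple fourfold isogeny factor, outside the printed (a)/(e)/(f)** — UNCONDITIONAL,
no displayed row. [cite: MoonenZarhin1999LowDim, Thm. 0.1 (4) and Thm. 0.2 (4)] [cite: Deligne2000, §1] -/
theorem hcOnClass_avDominatedBy_powSucc_dim_le_five :
    HCOnClass fun B => ∃ (X : AbelianVariety ℂ) (N : ℕ), 0 < X.dim ∧ X.dim ≤ 5 ∧ (X.dim = 5 → ¬ X.IsSimple) ∧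
      (∀ F : AbelianVariety ℂ, F.IsSimple → F.dim = 4 → ¬ AVDominatedBy F X) ∧
      (¬ ∃ E T : AbelianVariety ℂ, E.dim = 1 ∧ IsOfCMType E ∧ T.IsSimple ∧ T.dim = 3 ∧
        AVDominatedBy E X ∧ AVDominatedBy T X ∧ Nonempty (E.endAlgebra →+* T.endAlgebra)) ∧
      AVDominatedBy B (X.powSucc N) :=
  hcOnClass_avDominatedBy_powSucc_dim_le_five_of_rowST rowST

/- **On path**: the Hodge conjecture gives every target of this file (the tree's `hodgeConjectureFor_prod_of_hodgeConjecture'`);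
this file proves them unconditionally. -/
example (h : ∀ ⦃n : ℕ⦄ ⦃Y : Literature.AlgebraicGeometry.Motives.SchemeOver ℂ⦄,
      Literature.AlgebraicGeometry.Motives.IsSmoothProjective n Y → HodgeConjectureFor n Y) (X : AbelianVariety ℂ) :
    HodgeConjectureFor X.dim X.X :=
  h Literature.AlgebraicGeometry.Motives.AbelianVariety.isSmoothProjective_holds

end Summit.HodgeConjecture.Ring2.NonSimpleFivefolds

end
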